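import Literature.MathematicalPhysics.QuantumFieldTheory.Balaban1983to89.B1Eq324BenfattoSect5SlotMoments
import HarnessLib

/-!
# `Balaban1983to89.B1Eq324BenfattoKernelSect5SlotMoments` — [BenfattoEtAl1978] Appendix C 2) p. 164 / Appendix D p. 165, THE MOMENT
# INPUT «point 2)» FOR POLYNOMIAL SLOTS, FOR A GENERAL SHIFTED GAUSSIAN KERNEL FIELD `𝒩(0,K)∘(u + ·)⁻¹`: every polynomial
# `V(z) = Σᵢ aᵢ Π_{j∈Jᵢ} z_{x_{ij}}` of degree `≤ q` has `∫|V|ⁿ dμ_{K,u} ≤ ((1+Kᵤ)^q Σᵢ|aᵢ|)ⁿ · momentConst q n c₀` whenever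
# `K(y,y) ≤ c₀` (row R1) and `|u| ≤ Kᵤ` on the legs (row R3), PROVED; instances: print's tuple-class sums of (5.5)-terms; the knit
# with (5.29)'s first term «χ → 1» with this input DISCHARGED

statement-level skeleton of published theorems with citation tags; proofs where landed; nothing here is a claim about the
Yang–Mills mass gap

WHY THIS MODULE (cell `pub-ymgap`, seat `dag-n08-c` gen 31; node N08 [Balaban1985UV3]; the [BenfattoEtAl1978] source chain behind the
(α)-row `h324`; ROW 1 of the seat's cluster-side port map `N08-PORT-MAP-CLUSTER-SIDE.md` §1).  The tree's §5 road of [BenfattoEtAl1978]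
is typed against the free massive lattice field (1.1): the moment input «point 2)» of Appendix C — *"the conditioned variables
(z_Δ)_{Δ∉Γ} are a non centered gaussian field with: [centre (C.7)–(C.8), covariance (C.6)]"* (p. 164), used in Appendix D as *"The
replacement of the χ's by 1 is a trivial consequence of point 2) and Lemma 1 of Appendix C"* (p. 165) — lives in
`…B1Eq324BenfattoSect5SlotMoments` for the conditioned free field `P̄(dz|z̄_Γ) = condField d α β Γ z̄`, with the centre bound (C.8)
and the variance bound (C.6) SUPPLIED from `freeCov d α β`.  The class road (seats n08-b/n08-c/n08-d, notes `N08-BASICLEMMA-KERNEL-CENSUS.md`,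
`N08-PORT-MAP-CLUSTER-SIDE.md`, `N08-PORT-MAP-STRUCTURAL-SIDE.md`) re-reads §5 for the Gaussian field of a general positive-semidefinite
kernel; its per-box measures are PART FIELDS `N^K_{P,ξ} = (gaussianFieldOfKernel K_P).map (fun ζ x => condMean K Γ ξ x + ζ x)`
(`…KernelSect5Eq513`), and its pavement step (`…KernelSect5PavementStep.pavementStep_of_setIntegral`) takes per-box bounds under them as
hypotheses.  Every cluster-side estimate therefore has to be available for the SHIFTED KERNEL FIELD
`μ_{K,u} := (gaussianFieldOfKernel K).map (fun ζ y => u y + ζ y)` of a GENERIC kernel `K` and a GENERIC centre `u`, with the two inputs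
that the free field used to supply displayed as ROWS: R1 `∀ y, K y y ≤ c₀` (the sub-Gaussian parameter; concrete: `(freeCov d α β 0 0)⁺`
via `…AppendixC.condCov_self_le`) and R3 `|u(x_{ij})| ≤ Kᵤ` on the legs (concrete: (C.8), `(1 + 2d/α²)γb` via
`…Sect5SlotMoments.abs_condMean_le_of_mem`; for the class: `…KernelOfPrecision.abs_condMean_kernel_le_profile`).  This file is that
edition of `…Sect5SlotMoments` §3–§6: the SAME proofs, with the rewrite `condField_eq_map` deleted (the currency IS the push-forward) and the
(C.6)-step `hasSubgaussianMGF_eval_condCov` replaced by the kernel-generic `hasSubgaussianMGF_eval_gaussianFieldOfKernel hK y (hdiag y)`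
(§1 of the concrete module, already generic); the algebra (`poly_eval_shift_eq`, `sum_abs_shiftCoef_le`, `tupleSum_eq_poly`,
`legPairs_injective`, `card_legs`) and lit-balaban r14's `B1Eq324GaussianMomentLeaf` (`poly`, `momentConst`, `integral_abs_poly_pow_le`,
`integrable_abs_poly_pow`) are consumed BY NAME.  The currency is written as the literal term
`(gaussianFieldOfKernel K).map fun (ζ : S → ℝ) (y : S) => u y + ζ y` everywhere (the tree's convention since
`…KernelAppendixD` §1 / `…KernelCondToFree` §1 / `…KernelSect5Eq513`), so that consumers close by `exact`.

DICTIONARY.  `μ_{K,u}` ↦ `(gaussianFieldOfKernel K).map fun ζ y => u y + ζ y`; row R0 ↦ `hK : IsPosSemidefKernel K`; row R1 ↦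
`hdiag : ∀ y, K y y ≤ c₀` (`c₀ : ℝ≥0`); row R3 ↦ `hu : |u (x i j)| ≤ Kᵤ` on the legs (`Kᵤ ≥ 0`), or `∀ y ∈ I, |u y| ≤ Kᵤ` on a region
`I ⊇ J` carrying the slots (§2); a polynomial slot ↦ `poly I J a (fun i j z => z (x i j))` with legs `x : ι → κ → S`, `|Jᵢ| ≤ q`; print's
`H_R`, `H_{R,S}`, `Ψ_□`, `Ψ′₁`, `Ψ″₁`, `Ψ₂`, `Ψ₃` ↦ `fun z => Σ_{p∈Icc 1 s} Σ_{Δ∈T p} Σ_{n∈admissible p D} term ϰ a z p Δ n` (§2, `S := Site d`).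
The concrete module is the instance `K := condCov (freeCov d α β) Γ`, `u := condMean (freeCov d α β) Γ z̄`, `c₀ := (freeCov d α β 0 0)⁺`
(`…Sect5SlotMoments.condField_eq_map`, `rfl`).

WHAT IS PROVED (theorems only; no definition, no named fact, no `sorry`; axioms standard).
* §1 (any index type `S`) `integral_abs_poly_eval_pow_shift_le` — `∫|V|ⁿ dμ_{K,u} ≤ ((1+Kᵤ)^q Σᵢ|aᵢ|)ⁿ · momentConst q n c₀`;
  `integrable_abs_poly_eval_pow_shift` (every power); ★ `poly_eval_shift_moments` — THE PACKAGE `hZm / hZint / hZL` of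
  `…Sect5ChiToOne.abs_ursellOf_moment_mul_sub_le_of_moments` for a polynomial slot under `μ_{K,u}`, `L = (1+Kᵤ)^q(Σᵢ|aᵢ|)·momentConst q P c₀`.
* §2 (`S := Site d`, print's slots) `integral_abs_tupleSum_pow_shift_le` (`∫|slot|^m dμ_{K,u} ≤ ((1+Kᵤ)^D·𝓜)^m·momentConst D m c₀`,
  `𝓜 = Σ_pΣ_{Δ∈T p}Σ_n|A^n_Δ|e^{−(ϰ/2)d(Δ)}`), `integral_abs_tupleSum_pow_shift_le_of_coef_le` (`|A^n_Δ| ≤ A`), ★ `tupleSum_shift_moments`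
  (the package), `tupleSum_shift_moments_of_subset` (row R3 in region form `∀ y ∈ I, |u y| ≤ Kᵤ`, slots over `J ⊆ I` — the shape the
  per-box estimate reads).
* §3 ★★ `abs_ursellOf_poly_mul_sub_shift_le` — (5.29) FIRST TERM «χ → 1» for `k` polynomial slots under `μ_{K,u}`, the moment input
  DISCHARGED: `|𝓔^T(Z₁χ,…,Z_kχ) − 𝓔^T(Z₁,…,Z_k)| ≤ 2^k(Σ_π(|π|−1)!)·η·L^k`, `L = (1+Kᵤ)^q·M·momentConst q (2k) c₀`, the only remaining
  input being the tail `μ_{K,u}(χ ≠ 1) ≤ η^{2k}` (for the class: `…KernelAppendixCLemma2.appC_lemma2_of_shift`).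

HONEST SCOPE / NOT HERE.  (i) Constants as in the concrete module (r14's crude `momentConst`, the shift factor `(1+Kᵤ)^q`); (ii) the
rows R1/R3 are DISPLAYED, not discharged — at the class's per-box instance `(K_□, u_{Γ₁}(ξ))` they are
`…KernelOfPrecision.condCov_kernel_self_pos_le` / `…ClassAppendixC.inv_submatrix_apply_self_pos_le` and `abs_condMean_kernel_le_profile`
(port map §2), NOT restated here; (iii) one self-located row of an UNCOMMISSIONED port (plan g81 (II), START-LIST v11 §n08): nothing is
chained to it here; no generalised Basic Lemma is stated; nothing of [Balaban1985UV3] (41)/(47)/(5) is asserted; count-neutral for N08;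
nothing about d = 4, the continuum, OS axioms, a mass gap or the Clay problem.
-/

open Finset MeasureTheory
open scoped BigOperators NNReal

namespace Literature.MathematicalPhysics.QuantumFieldTheory.Balaban1983to89.B1Eq324BenfattoKernelSect5SlotMoments

open _root_.MeasureTheory _root_.ProbabilityTheory
open Literature.MathematicalPhysics.QuantumFieldTheory
open Literature.MathematicalPhysics.QuantumFieldTheory.Balaban1983to89.B1Eq324GaussianMomentLeaf
  (poly momentConst one_le_momentConst momentConst_mono integral_abs_poly_pow_le integrable_abs_poly_pow)
open Literature.MathematicalPhysics.QuantumFieldTheory.Balaban1983to89.B1Eq324BenfattoLemma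
open Literature.MathematicalPhysics.QuantumFieldTheory.Balaban1983to89.B1Eq324BenfattoConnLength (connLength_nonneg)
open Literature.MathematicalPhysics.QuantumFieldTheory.Balaban1983to89.B1Eq324BenfattoSect5Eq511 (term)
open Literature.MathematicalPhysics.QuantumFieldTheory.Balaban1983to89.B1Eq324BenfattoSect5SlotMoments
  (hasSubgaussianMGF_eval_gaussianFieldOfKernel poly_eval_shift_eq sum_abs_shiftCoef_le legPairs_injective card_legs
   tupleSum_eq_poly)
open Literature.MathematicalPhysics.QuantumFieldTheory.Balaban1983to89.B1Eq324BenfattoSect5ChiToOne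
  (abs_ursellOf_moment_mul_sub_le_of_moments)
open Literature.Probability.LatticeModels (setPartitions ursellOf)

/-! ## §1  Polynomial slots under a shifted Gaussian kernel field `μ_{K,u} = 𝒩(0,K)∘(u + ·)⁻¹` -/

section Shift

variable {S : Type*} [DecidableEq S] {K : S → S → ℝ} {ι κ : Type*} [DecidableEq κ]

/-- **THE `n`-TH ABSOLUTE MOMENT OF A POLYNOMIAL SLOT UNDER A SHIFTED KERNEL FIELD** («point 2)» of Appendix C as the moment input of
(5.29), kernel-generic): for a positive-semidefinite kernel `K` on any index set with diagonal `K(y,y) ≤ c₀` (row R1), a centre `u`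
with `|u(x_{ij})| ≤ Kᵤ` on the legs (row R3, `Kᵤ ≥ 0`) and `V(z) = Σ_{i∈I} aᵢ Π_{j∈Jᵢ} z(x_{ij})` with `|Jᵢ| ≤ q`,
`∫ |V|ⁿ d[(μ_K).map (u + ·)] ≤ ((1+Kᵤ)^q · Σᵢ|aᵢ|)ⁿ · momentConst q n c₀` — change variables to the centred field, re-expand
(`…Sect5SlotMoments.poly_eval_shift_eq`), and apply r14's `B1Eq324GaussianMomentLeaf.integral_abs_poly_pow_le` to the sub-Gaussian
centred coordinates (`…Sect5SlotMoments.hasSubgaussianMGF_eval_gaussianFieldOfKernel`).  The concrete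
`…Sect5SlotMoments.integral_abs_poly_eval_pow_condField_le` is the instance `K := condCov (freeCov d α β) Γ`, `u := condMean … z̄`.
[cite: BenfattoEtAl1978, Appendix C 2) p.164 and Appendix D p.165] -/
theorem integral_abs_poly_eval_pow_shift_le (hK : IsPosSemidefKernel K) (u : S → ℝ) {c₀ : ℝ≥0} (hdiag : ∀ y, K y y ≤ c₀)
    (I : Finset ι) (J : ι → Finset κ) (a : ι → ℝ) (x : ι → κ → S) {Ku : ℝ} (hKu : 0 ≤ Ku)
    (hu : ∀ i ∈ I, ∀ j ∈ J i, |u (x i j)| ≤ Ku) {q : ℕ} (hq : ∀ i ∈ I, (J i).card ≤ q) (n : ℕ) :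
    ∫ z, |poly I J a (fun i j (z : S → ℝ) => z (x i j)) z| ^ n
        ∂((gaussianFieldOfKernel K).map fun (ζ : S → ℝ) (y : S) => u y + ζ y) ≤
      ((1 + Ku) ^ q * ∑ i ∈ I, |a i|) ^ n * momentConst q n c₀ := by
  haveI := isProbabilityMeasure_gaussianFieldOfKernel hK
  have hTm : Measurable (fun (ζ : S → ℝ) (y : S) => u y + ζ y) :=
    measurable_pi_lambda _ fun y => measurable_const.add (measurable_pi_apply y)
  have hPm : Measurable (poly I J a (fun i j (z : S → ℝ) => z (x i j))) := by
    change Measurable fun z : S → ℝ => ∑ i ∈ I, a i * ∏ j ∈ J i, z (x i j)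
    refine Finset.measurable_sum I fun i _ => ?_
    exact (Finset.measurable_prod (J i) fun j _ => measurable_pi_apply (x i j)).const_mul (a i)
  have hVm : Measurable fun z : S → ℝ => |poly I J a (fun i j (z : S → ℝ) => z (x i j)) z| ^ n :=
    (continuous_abs.measurable.comp hPm).pow_const n
  rw [integral_map hTm.aemeasurable hVm.aestronglyMeasurable]
  have hshift : ∀ ζ : S → ℝ,
      poly I J a (fun i j (z : S → ℝ) => z (x i j)) (fun y => u y + ζ y) =
        poly (I.sigma fun i => (J i).powerset) (fun m => J m.1 \ m.2) (fun m => a m.1 * ∏ j ∈ m.2, u (x m.1 j))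
          (fun m j (ζ : S → ℝ) => ζ (x m.1 j)) ζ :=
    poly_eval_shift_eq I J a x u
  simp only [hshift]
  have hsg : ∀ m ∈ I.sigma (fun i => (J i).powerset), ∀ j ∈ J m.1 \ m.2,
      HasSubgaussianMGF (fun ζ : S → ℝ => ζ (x m.1 j)) c₀ (gaussianFieldOfKernel K) :=
    fun m _ j _ => hasSubgaussianMGF_eval_gaussianFieldOfKernel hK (x m.1 j) (hdiag _)
  have hq' : ∀ m ∈ I.sigma (fun i => (J i).powerset), (J m.1 \ m.2).card ≤ q := fun m hm =>
    (Finset.card_le_card Finset.sdiff_subset).trans (hq m.1 (Finset.mem_sigma.1 hm).1)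
  refine (integral_abs_poly_pow_le hsg hq' n).trans ?_
  have hmc : 0 ≤ momentConst q n c₀ := zero_le_one.trans (one_le_momentConst _ _ _)
  exact mul_le_mul_of_nonneg_right (pow_le_pow_left₀ (Finset.sum_nonneg fun m _ => abs_nonneg _)
    (sum_abs_shiftCoef_le I J a x u hKu hu hq) n) hmc

/-- Every power `|V|^p` of a polynomial slot is integrable under the shifted kernel field (row R0 only).
[cite: BenfattoEtAl1978, Appendix C 2) p.164] -/
theorem integrable_abs_poly_eval_pow_shift (hK : IsPosSemidefKernel K) (u : S → ℝ) {c₀ : ℝ≥0} (hdiag : ∀ y, K y y ≤ c₀)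
    (I : Finset ι) (J : ι → Finset κ) (a : ι → ℝ) (x : ι → κ → S) (p : ℕ) :
    Integrable (fun z => |poly I J a (fun i j (z : S → ℝ) => z (x i j)) z| ^ p)
      ((gaussianFieldOfKernel K).map fun (ζ : S → ℝ) (y : S) => u y + ζ y) := by
  haveI := isProbabilityMeasure_gaussianFieldOfKernel hK
  have hTm : Measurable (fun (ζ : S → ℝ) (y : S) => u y + ζ y) :=
    measurable_pi_lambda _ fun y => measurable_const.add (measurable_pi_apply y)
  have hPm : Measurable (poly I J a (fun i j (z : S → ℝ) => z (x i j))) := by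
    change Measurable fun z : S → ℝ => ∑ i ∈ I, a i * ∏ j ∈ J i, z (x i j)
    refine Finset.measurable_sum I fun i _ => ?_
    exact (Finset.measurable_prod (J i) fun j _ => measurable_pi_apply (x i j)).const_mul (a i)
  have hVm : Measurable fun z : S → ℝ => |poly I J a (fun i j (z : S → ℝ) => z (x i j)) z| ^ p :=
    (continuous_abs.measurable.comp hPm).pow_const p
  rw [integrable_map_measure hVm.aestronglyMeasurable hTm.aemeasurable]
  have hshift : ∀ ζ : S → ℝ,
      poly I J a (fun i j (z : S → ℝ) => z (x i j)) (fun y => u y + ζ y) =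
        poly (I.sigma fun i => (J i).powerset) (fun m => J m.1 \ m.2) (fun m => a m.1 * ∏ j ∈ m.2, u (x m.1 j))
          (fun m j (ζ : S → ℝ) => ζ (x m.1 j)) ζ :=
    poly_eval_shift_eq I J a x u
  simp only [Function.comp_def, hshift]
  have hsg : ∀ m ∈ I.sigma (fun i => (J i).powerset), ∀ j ∈ J m.1 \ m.2,
      HasSubgaussianMGF (fun ζ : S → ℝ => ζ (x m.1 j)) c₀ (gaussianFieldOfKernel K) :=
    fun m _ j _ => hasSubgaussianMGF_eval_gaussianFieldOfKernel hK (x m.1 j) (hdiag _)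
  exact integrable_abs_poly_pow hsg p

/-- **THE MOMENT PACKAGE OF A POLYNOMIAL SLOT UNDER A SHIFTED KERNEL FIELD** — exactly the hypotheses `hZm / hZint / hZL` of
`B1Eq324BenfattoSect5ChiToOne.abs_ursellOf_moment_mul_sub_le_of_moments` for the slot `V` under `μ_{K,u}`: `V` is (a.e. strongly)
measurable, every `|V|^p` is integrable, and with ONE constant `L = (1+Kᵤ)^q (Σᵢ|aᵢ|) · momentConst q P c₀` one has `∫|V|^p dμ_{K,u} ≤ L^p`
for all `p ≤ P` (`momentConst ≥ 1`, monotone in the order).  Rows: R0 `hK`, R1 `hdiag`, R3 `hu`.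
[cite: BenfattoEtAl1978, Appendix D p.165 «a trivial consequence of point 2)»] -/
theorem poly_eval_shift_moments (hK : IsPosSemidefKernel K) (u : S → ℝ) {c₀ : ℝ≥0} (hdiag : ∀ y, K y y ≤ c₀)
    (I : Finset ι) (J : ι → Finset κ) (a : ι → ℝ) (x : ι → κ → S) {Ku : ℝ} (hKu : 0 ≤ Ku)
    (hu : ∀ i ∈ I, ∀ j ∈ J i, |u (x i j)| ≤ Ku) {q : ℕ} (hq : ∀ i ∈ I, (J i).card ≤ q) (P : ℕ) :
    AEStronglyMeasurable (poly I J a (fun i j (z : S → ℝ) => z (x i j)))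
        ((gaussianFieldOfKernel K).map fun (ζ : S → ℝ) (y : S) => u y + ζ y) ∧
    (∀ p : ℕ, Integrable (fun z => |poly I J a (fun i j (z : S → ℝ) => z (x i j)) z| ^ p)
        ((gaussianFieldOfKernel K).map fun (ζ : S → ℝ) (y : S) => u y + ζ y)) ∧
    ∀ p : ℕ, p ≤ P →
      ∫ z, |poly I J a (fun i j (z : S → ℝ) => z (x i j)) z| ^ p
          ∂((gaussianFieldOfKernel K).map fun (ζ : S → ℝ) (y : S) => u y + ζ y) ≤
        ((1 + Ku) ^ q * (∑ i ∈ I, |a i|) * momentConst q P c₀) ^ p := by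
  haveI := isProbabilityMeasure_gaussianFieldOfKernel hK
  have hTm : Measurable (fun (ζ : S → ℝ) (y : S) => u y + ζ y) :=
    measurable_pi_lambda _ fun y => measurable_const.add (measurable_pi_apply y)
  haveI : IsProbabilityMeasure ((gaussianFieldOfKernel K).map fun (ζ : S → ℝ) (y : S) => u y + ζ y) :=
    Measure.isProbabilityMeasure_map hTm.aemeasurable
  have hPm : Measurable (poly I J a (fun i j (z : S → ℝ) => z (x i j))) := by
    change Measurable fun z : S → ℝ => ∑ i ∈ I, a i * ∏ j ∈ J i, z (x i j)
    refine Finset.measurable_sum I fun i _ => ?_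
    exact (Finset.measurable_prod (J i) fun j _ => measurable_pi_apply (x i j)).const_mul (a i)
  refine ⟨hPm.aestronglyMeasurable, integrable_abs_poly_eval_pow_shift hK u hdiag I J a x, fun p hp => ?_⟩
  set M := (1 + Ku) ^ q * ∑ i ∈ I, |a i| with hM
  have hM0 : 0 ≤ M := mul_nonneg (pow_nonneg (by linarith) _) (Finset.sum_nonneg fun i _ => abs_nonneg _)
  have h1 := one_le_momentConst q P c₀
  rcases Nat.eq_zero_or_pos p with rfl | hp0
  · simp only [pow_zero, integral_const, probReal_univ, smul_eq_mul, mul_one, le_refl]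
  calc ∫ z, |poly I J a (fun i j (z : S → ℝ) => z (x i j)) z| ^ p
          ∂((gaussianFieldOfKernel K).map fun (ζ : S → ℝ) (y : S) => u y + ζ y)
      ≤ M ^ p * momentConst q p c₀ := integral_abs_poly_eval_pow_shift_le hK u hdiag I J a x hKu hu hq p
    _ ≤ M ^ p * momentConst q P c₀ ^ p := by
        refine mul_le_mul_of_nonneg_left ?_ (pow_nonneg hM0 _)
        calc momentConst q p c₀ ≤ momentConst q P c₀ := momentConst_mono q hp c₀
          _ = momentConst q P c₀ ^ 1 := (pow_one _).symm
          _ ≤ momentConst q P c₀ ^ p := pow_le_pow_right₀ h1 hp0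
    _ = (M * momentConst q P c₀) ^ p := (mul_pow _ _ _).symm

end Shift

/-! ## §2  Print's slots under a shifted kernel field on the lattice: tuple-class sums of the (5.5)-terms -/

section TupleSums

variable {d : ℕ} {K : B1Eq324BenfattoLemma.Site d → B1Eq324BenfattoLemma.Site d → ℝ} {s D : ℕ} {ϰ : ℝ} {a : Coef d}
  {Jr : Finset (B1Eq324BenfattoLemma.Site d)}

/-- **THE MOMENTS OF PRINT'S POLYNOMIAL SLOTS UNDER A SHIFTED KERNEL FIELD** (`H_R`, `H_{R,S}`, `Ψ_□`, `Ψ′₁`, `Ψ″₁`, `Ψ₂`, `Ψ₃`, … —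
any tuple-class sum of (5.5)-terms over `J`): with rows R0 `hK`, R1 `K(y,y) ≤ c₀` and R3 `|u(y)| ≤ Kᵤ` on `J` (`Kᵤ ≥ 0`), for every `m`
`∫ |Σ_{p∈Icc 1 s} Σ_{Δ∈T p} Σ_{n} A^n_Δ e^{−(ϰ/2)d(Δ)} Π z_{Δᵢ}^{nᵢ}|^m dμ_{K,u} ≤ ((1+Kᵤ)^D · 𝓜)^m · momentConst D m c₀`, with the
decay-weighted coefficient mass `𝓜 = Σ_pΣ_{Δ∈T p}Σ_n |A^n_Δ| e^{−(ϰ/2)d(Δ)}` (a tuple-class sum IS a `poly` of degree `≤ D`: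
`…Sect5SlotMoments.tupleSum_eq_poly`).  The concrete `…Sect5SlotMoments.integral_abs_tupleSum_pow_condField_le` is the instance
`K := condCov (freeCov d α β) Γ`, `u := condMean … z̄`. [cite: BenfattoEtAl1978, Appendix C 2) p.164 and (5.29) p.158] -/
theorem integral_abs_tupleSum_pow_shift_le (hK : IsPosSemidefKernel K) (u : B1Eq324BenfattoLemma.Site d → ℝ) {c₀ : ℝ≥0}
    (hdiag : ∀ y, K y y ≤ c₀) (T : (p : ℕ) → Finset (Fin p → Jr)) {Ku : ℝ} (hKu : 0 ≤ Ku)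
    (hu : ∀ y ∈ Jr, |u y| ≤ Ku) (m : ℕ) :
    ∫ z, |∑ p ∈ Finset.Icc 1 s, ∑ Δ ∈ T p, ∑ n ∈ admissible p D, term ϰ a z p Δ n| ^ m
        ∂((gaussianFieldOfKernel K).map
          fun (ζ : B1Eq324BenfattoLemma.Site d → ℝ) (y : B1Eq324BenfattoLemma.Site d) => u y + ζ y) ≤
      ((1 + Ku) ^ D * ∑ p ∈ Finset.Icc 1 s, ∑ Δ ∈ T p, ∑ n ∈ admissible p D,
          |a p (fun i => (Δ i : B1Eq324BenfattoLemma.Site d)) n| *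
            Real.exp (-(ϰ / 2) * connLength fun i => (Δ i : B1Eq324BenfattoLemma.Site d))) ^ m *
        momentConst D m c₀ := by
  classical
  simp_rw [tupleSum_eq_poly T]
  have hlegs : ∀ mm ∈ (Finset.Icc 1 s).sigma (fun p => T p ×ˢ admissible p D),
      ∀ kr ∈ ((Finset.univ : Finset (Fin mm.1)).sigma fun i => Finset.range (mm.2.2 i)).map ⟨_, legPairs_injective mm.1⟩,
        |u ((fun k : ℕ => if h : k < mm.1 then (mm.2.1 ⟨k, h⟩ : B1Eq324BenfattoLemma.Site d)
          else (0 : B1Eq324BenfattoLemma.Site d)) kr.1)| ≤ Ku := by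
    intro mm _ kr hkr
    obtain ⟨⟨i, r⟩, _, rfl⟩ := Finset.mem_map.1 hkr
    simp only [Function.Embedding.coeFn_mk, Fin.is_lt, dif_pos, Fin.eta]
    exact hu _ (mm.2.1 i).2
  have hdeg : ∀ mm ∈ (Finset.Icc 1 s).sigma (fun p => T p ×ˢ admissible p D),
      (((Finset.univ : Finset (Fin mm.1)).sigma fun i => Finset.range (mm.2.2 i)).map ⟨_, legPairs_injective mm.1⟩).card ≤ D := by
    intro mm hmm
    rw [card_legs]
    exact (mem_admissible.1 (Finset.mem_product.1 (Finset.mem_sigma.1 hmm).2).2).2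
  refine (integral_abs_poly_eval_pow_shift_le hK u hdiag _ _ _ _ hKu hlegs hdeg m).trans (le_of_eq ?_)
  congr 3
  rw [Finset.sum_sigma]
  refine Finset.sum_congr rfl fun p _ => ?_
  rw [Finset.sum_product]
  refine Finset.sum_congr rfl fun Δ _ => Finset.sum_congr rfl fun n _ => ?_
  rw [abs_mul, Real.abs_exp]

/-- **The same with `A ≡ sup|A^n_Δ|`** ((4.5)): if moreover `|A^n_Δ| ≤ A` and `ϰ ≥ 0`, then `𝓜 ≤ A · Σ_{p∈Icc 1 s} |T p| · |admissible p D|`,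
so `∫|slot|^m dμ_{K,u} ≤ ((1+Kᵤ)^D · A · Σ_p |T p|·|admissible p D|)^m · momentConst D m c₀`.
[cite: BenfattoEtAl1978, Appendix C 2) p.164 and (5.29) p.158] -/
theorem integral_abs_tupleSum_pow_shift_le_of_coef_le (hK : IsPosSemidefKernel K) (u : B1Eq324BenfattoLemma.Site d → ℝ)
    {c₀ : ℝ≥0} (hdiag : ∀ y, K y y ≤ c₀) (T : (p : ℕ) → Finset (Fin p → Jr)) {Ku : ℝ} (hKu : 0 ≤ Ku)
    (hu : ∀ y ∈ Jr, |u y| ≤ Ku) (hϰ : 0 ≤ ϰ) {A : ℝ}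
    (hA : ∀ (p : ℕ) (Δ : Fin p → B1Eq324BenfattoLemma.Site d) (n : Fin p → ℕ), |a p Δ n| ≤ A) (m : ℕ) :
    ∫ z, |∑ p ∈ Finset.Icc 1 s, ∑ Δ ∈ T p, ∑ n ∈ admissible p D, term ϰ a z p Δ n| ^ m
        ∂((gaussianFieldOfKernel K).map
          fun (ζ : B1Eq324BenfattoLemma.Site d → ℝ) (y : B1Eq324BenfattoLemma.Site d) => u y + ζ y) ≤
      ((1 + Ku) ^ D * (A * ∑ p ∈ Finset.Icc 1 s, ((T p).card : ℝ) * (admissible p D).card)) ^ m *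
        momentConst D m c₀ := by
  have hA0 : 0 ≤ A := (abs_nonneg _).trans (hA 0 (fun i => i.elim0) (fun i => i.elim0))
  refine (integral_abs_tupleSum_pow_shift_le hK u hdiag T hKu hu m).trans ?_
  have hmc : 0 ≤ momentConst D m c₀ := zero_le_one.trans (one_le_momentConst _ _ _)
  refine mul_le_mul_of_nonneg_right (pow_le_pow_left₀ (mul_nonneg (pow_nonneg (by linarith) _)
    (Finset.sum_nonneg fun p _ => Finset.sum_nonneg fun Δ _ => Finset.sum_nonneg fun n _ =>
      mul_nonneg (abs_nonneg _) (Real.exp_pos _).le)) (mul_le_mul_of_nonneg_left ?_ (pow_nonneg (by linarith) _)) m) hmc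
  rw [Finset.mul_sum]
  refine Finset.sum_le_sum fun p _ => ?_
  calc ∑ Δ ∈ T p, ∑ n ∈ admissible p D, |a p (fun i => (Δ i : B1Eq324BenfattoLemma.Site d)) n| *
          Real.exp (-(ϰ / 2) * connLength fun i => (Δ i : B1Eq324BenfattoLemma.Site d))
      ≤ ∑ Δ ∈ T p, ∑ _n ∈ admissible p D, A := by
        refine Finset.sum_le_sum fun Δ _ => Finset.sum_le_sum fun n _ => ?_
        have hexp : Real.exp (-(ϰ / 2) * connLength fun i => (Δ i : B1Eq324BenfattoLemma.Site d)) ≤ 1 := by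
          rw [Real.exp_le_one_iff]
          have := connLength_nonneg (fun i => (Δ i : B1Eq324BenfattoLemma.Site d))
          nlinarith
        calc |a p (fun i => (Δ i : B1Eq324BenfattoLemma.Site d)) n| *
              Real.exp (-(ϰ / 2) * connLength fun i => (Δ i : B1Eq324BenfattoLemma.Site d))
            ≤ A * 1 := mul_le_mul (hA _ _ _) hexp (Real.exp_pos _).le hA0
          _ = A := mul_one A
    _ = A * (((T p).card : ℝ) * (admissible p D).card) := by
        simp only [Finset.sum_const, nsmul_eq_mul]
        ring

/-- **THE MOMENT PACKAGE OF PRINT'S SLOTS UNDER A SHIFTED KERNEL FIELD** — `hZm / hZint / hZL` of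
`B1Eq324BenfattoSect5ChiToOne.abs_ursellOf_moment_mul_sub_le_of_moments` for a tuple-class sum of (5.5)-terms under `μ_{K,u}`: measurable,
every power integrable, and `∫|slot|^p dμ_{K,u} ≤ L^p` for all `p ≤ P` with `L = (1+Kᵤ)^D · 𝓜 · momentConst D P c₀`.  Rows: R0 `hK`, R1 `hdiag`,
R3 `hu` on `J`. [cite: BenfattoEtAl1978, Appendix D p.165 «a trivial consequence of point 2)»] -/
theorem tupleSum_shift_moments (hK : IsPosSemidefKernel K) (u : B1Eq324BenfattoLemma.Site d → ℝ) {c₀ : ℝ≥0}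
    (hdiag : ∀ y, K y y ≤ c₀) (T : (p : ℕ) → Finset (Fin p → Jr)) {Ku : ℝ} (hKu : 0 ≤ Ku)
    (hu : ∀ y ∈ Jr, |u y| ≤ Ku) (P : ℕ) :
    AEStronglyMeasurable (fun z : B1Eq324BenfattoLemma.Site d → ℝ =>
        ∑ p ∈ Finset.Icc 1 s, ∑ Δ ∈ T p, ∑ n ∈ admissible p D, term ϰ a z p Δ n)
        ((gaussianFieldOfKernel K).map
          fun (ζ : B1Eq324BenfattoLemma.Site d → ℝ) (y : B1Eq324BenfattoLemma.Site d) => u y + ζ y) ∧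
    (∀ q : ℕ, Integrable (fun z : B1Eq324BenfattoLemma.Site d → ℝ =>
        |∑ p ∈ Finset.Icc 1 s, ∑ Δ ∈ T p, ∑ n ∈ admissible p D, term ϰ a z p Δ n| ^ q)
        ((gaussianFieldOfKernel K).map
          fun (ζ : B1Eq324BenfattoLemma.Site d → ℝ) (y : B1Eq324BenfattoLemma.Site d) => u y + ζ y)) ∧
    ∀ q : ℕ, q ≤ P →
      ∫ z, |∑ p ∈ Finset.Icc 1 s, ∑ Δ ∈ T p, ∑ n ∈ admissible p D, term ϰ a z p Δ n| ^ q
          ∂((gaussianFieldOfKernel K).map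
            fun (ζ : B1Eq324BenfattoLemma.Site d → ℝ) (y : B1Eq324BenfattoLemma.Site d) => u y + ζ y) ≤
        ((1 + Ku) ^ D * (∑ p ∈ Finset.Icc 1 s, ∑ Δ ∈ T p, ∑ n ∈ admissible p D,
            |a p (fun i => (Δ i : B1Eq324BenfattoLemma.Site d)) n| *
              Real.exp (-(ϰ / 2) * connLength fun i => (Δ i : B1Eq324BenfattoLemma.Site d))) *
          momentConst D P c₀) ^ q := by
  classical
  have hlegs : ∀ mm ∈ (Finset.Icc 1 s).sigma (fun p => T p ×ˢ admissible p D),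
      ∀ kr ∈ ((Finset.univ : Finset (Fin mm.1)).sigma fun i => Finset.range (mm.2.2 i)).map ⟨_, legPairs_injective mm.1⟩,
        |u ((fun k : ℕ => if h : k < mm.1 then (mm.2.1 ⟨k, h⟩ : B1Eq324BenfattoLemma.Site d)
          else (0 : B1Eq324BenfattoLemma.Site d)) kr.1)| ≤ Ku := by
    intro mm _ kr hkr
    obtain ⟨⟨i, r⟩, _, rfl⟩ := Finset.mem_map.1 hkr
    simp only [Function.Embedding.coeFn_mk, Fin.is_lt, dif_pos, Fin.eta]
    exact hu _ (mm.2.1 i).2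
  have hdeg : ∀ mm ∈ (Finset.Icc 1 s).sigma (fun p => T p ×ˢ admissible p D),
      (((Finset.univ : Finset (Fin mm.1)).sigma fun i => Finset.range (mm.2.2 i)).map ⟨_, legPairs_injective mm.1⟩).card ≤ D := by
    intro mm hmm
    rw [card_legs]
    exact (mem_admissible.1 (Finset.mem_product.1 (Finset.mem_sigma.1 hmm).2).2).2
  obtain ⟨h1, h2, h3⟩ := poly_eval_shift_moments hK u hdiag _ _ _ _ hKu hlegs hdeg P
  have hfun : (fun z : B1Eq324BenfattoLemma.Site d → ℝ =>
      ∑ p ∈ Finset.Icc 1 s, ∑ Δ ∈ T p, ∑ n ∈ admissible p D, term ϰ a z p Δ n) = _ :=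
    funext fun z => tupleSum_eq_poly (s := s) (D := D) (ϰ := ϰ) (a := a) T z
  have hmass : ∑ mm ∈ (Finset.Icc 1 s).sigma (fun p => T p ×ˢ admissible p D),
      |a mm.1 (fun i => (mm.2.1 i : B1Eq324BenfattoLemma.Site d)) mm.2.2 *
        Real.exp (-(ϰ / 2) * connLength fun i => (mm.2.1 i : B1Eq324BenfattoLemma.Site d))| =
      ∑ p ∈ Finset.Icc 1 s, ∑ Δ ∈ T p, ∑ n ∈ admissible p D,
        |a p (fun i => (Δ i : B1Eq324BenfattoLemma.Site d)) n| *
          Real.exp (-(ϰ / 2) * connLength fun i => (Δ i : B1Eq324BenfattoLemma.Site d)) := by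
    rw [Finset.sum_sigma]
    refine Finset.sum_congr rfl fun p _ => ?_
    rw [Finset.sum_product]
    refine Finset.sum_congr rfl fun Δ _ => Finset.sum_congr rfl fun n _ => ?_
    rw [abs_mul, Real.abs_exp]
  refine ⟨?_, fun q => ?_, fun q hq => ?_⟩
  · rw [hfun]; exact h1
  · simp_rw [tupleSum_eq_poly T]; exact h2 q
  · simp_rw [tupleSum_eq_poly T]
    rw [← hmass]
    exact h3 q hq

/-- **THE MOMENT PACKAGE OF PRINT'S SLOTS, ROW R3 IN REGION FORM**: for a tuple-class sum of (5.5)-terms over `J ⊆ I` under `μ_{K,u}`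
with the centre bound `|u(y)| ≤ Kᵤ` on the REGION `I` (`Kᵤ ≥ 0`; concrete: (C.8) on the small-field data, `Kᵤ = (1 + 2d/α²)γb`,
`…Sect5SlotMoments.tupleSum_condField_moments_of_smallFieldData`; class: the centre profile on `χ^{Γ₁}_{γb}`): measurable, every power
integrable, and `∫|slot|^p dμ_{K,u} ≤ L^p` (`p ≤ P`) with `L = (1+Kᵤ)^D · 𝓜 · momentConst D P c₀`.
[cite: BenfattoEtAl1978, Appendix C 2) (C.8) p.164 and (5.29) p.158] -/
theorem tupleSum_shift_moments_of_subset (hK : IsPosSemidefKernel K) (u : B1Eq324BenfattoLemma.Site d → ℝ) {c₀ : ℝ≥0}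
    (hdiag : ∀ y, K y y ≤ c₀) (I : Finset (B1Eq324BenfattoLemma.Site d)) {Ku : ℝ} (hKu : 0 ≤ Ku)
    (hu : ∀ y ∈ I, |u y| ≤ Ku) (hJI : Jr ⊆ I) (T : (p : ℕ) → Finset (Fin p → Jr)) (P : ℕ) :
    AEStronglyMeasurable (fun z : B1Eq324BenfattoLemma.Site d → ℝ =>
        ∑ p ∈ Finset.Icc 1 s, ∑ Δ ∈ T p, ∑ n ∈ admissible p D, term ϰ a z p Δ n)
        ((gaussianFieldOfKernel K).map
          fun (ζ : B1Eq324BenfattoLemma.Site d → ℝ) (y : B1Eq324BenfattoLemma.Site d) => u y + ζ y) ∧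
    (∀ q : ℕ, Integrable (fun z : B1Eq324BenfattoLemma.Site d → ℝ =>
        |∑ p ∈ Finset.Icc 1 s, ∑ Δ ∈ T p, ∑ n ∈ admissible p D, term ϰ a z p Δ n| ^ q)
        ((gaussianFieldOfKernel K).map
          fun (ζ : B1Eq324BenfattoLemma.Site d → ℝ) (y : B1Eq324BenfattoLemma.Site d) => u y + ζ y)) ∧
    ∀ q : ℕ, q ≤ P →
      ∫ z, |∑ p ∈ Finset.Icc 1 s, ∑ Δ ∈ T p, ∑ n ∈ admissible p D, term ϰ a z p Δ n| ^ q
          ∂((gaussianFieldOfKernel K).map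
            fun (ζ : B1Eq324BenfattoLemma.Site d → ℝ) (y : B1Eq324BenfattoLemma.Site d) => u y + ζ y) ≤
        ((1 + Ku) ^ D * (∑ p ∈ Finset.Icc 1 s, ∑ Δ ∈ T p, ∑ n ∈ admissible p D,
            |a p (fun i => (Δ i : B1Eq324BenfattoLemma.Site d)) n| *
              Real.exp (-(ϰ / 2) * connLength fun i => (Δ i : B1Eq324BenfattoLemma.Site d))) *
          momentConst D P c₀) ^ q :=
  tupleSum_shift_moments hK u hdiag T hKu (fun y hy => hu y (hJI hy)) P

end TupleSums

/-! ## §3  The knit: (5.29) first term «χ → 1» for POLYNOMIAL slots under a shifted kernel field, the moment input DISCHARGED -/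

section ChiToOnePoly

open scoped Nat

variable {S : Type*} [DecidableEq S] {K : S → S → ℝ} {ι κ σ : Type*} [DecidableEq κ] [Fintype σ] [DecidableEq σ] [Nonempty σ]

/-- **(5.29), FIRST TERM, FOR POLYNOMIAL SLOTS UNDER A SHIFTED KERNEL FIELD — «a trivial consequence of point 2) and Lemma 1 of Appendix C»**:
for `k = |σ|` polynomial slots `Z_j(z) = Σ_{i∈I_j} a_{ji} Π_{l∈J_{ji}} z(x_{jil})` under `μ_{K,u} = 𝒩(0,K)∘(u + ·)⁻¹` (rows R0 `hK`, R1
`K(y,y) ≤ c₀`, R3 `|u| ≤ Kᵤ` on the legs; degrees `≤ q`, coefficient masses `Σᵢ|a_{ji}| ≤ M`), and one weight `0 ≤ χ ≤ 1` with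
`μ_{K,u}(χ ≠ 1) ≤ η^{2k}` (`0 ≤ η ≤ 1`; for the class: `…KernelAppendixCLemma2.appC_lemma2_of_shift`), the replacement of the χ's by 1 costs
`|𝓔^T(Z₁χ,…,Z_kχ) − 𝓔^T(Z₁,…,Z_k)| ≤ 2^k·(Σ_{π∈𝒫(k)}(|π|−1)!)·η·L^k`, `L = (1+Kᵤ)^q · M · momentConst q (2k) c₀` — n08-b's measure-generic
`B1Eq324BenfattoSect5ChiToOne.abs_ursellOf_moment_mul_sub_le_of_moments` with `hZm / hZint / hZL` supplied by `poly_eval_shift_moments`.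
The concrete `…Sect5SlotMoments.abs_ursellOf_poly_mul_sub_le` is the instance `K := condCov (freeCov d α β) Γ`, `u := condMean … z̄`.
[cite: BenfattoEtAl1978, (5.29) p.157–158 and Appendix D p.165] -/
theorem abs_ursellOf_poly_mul_sub_shift_le (hK : IsPosSemidefKernel K) (u : S → ℝ) {c₀ : ℝ≥0} (hdiag : ∀ y, K y y ≤ c₀)
    (I : σ → Finset ι) (J : σ → ι → Finset κ) (a : σ → ι → ℝ) (x : σ → ι → κ → S) {Ku : ℝ} (hKu : 0 ≤ Ku)
    (hu : ∀ j, ∀ i ∈ I j, ∀ l ∈ J j i, |u (x j i l)| ≤ Ku) {q : ℕ}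
    (hq : ∀ j, ∀ i ∈ I j, (J j i).card ≤ q) {M : ℝ} (hM : ∀ j, ∑ i ∈ I j, |a j i| ≤ M)
    {χ : (S → ℝ) → ℝ} (hχm : Measurable χ) (hχ0 : ∀ z, 0 ≤ χ z) (hχ1 : ∀ z, χ z ≤ 1)
    {η : ℝ} (hη0 : 0 ≤ η) (hη1 : η ≤ 1)
    (htail : ((gaussianFieldOfKernel K).map fun (ζ : S → ℝ) (y : S) => u y + ζ y).real {z | χ z ≠ 1} ≤
      η ^ (2 * Fintype.card σ)) :
    |ursellOf (fun P : Finset σ => ∫ z, ∏ j ∈ P,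
          poly (I j) (J j) (a j) (fun i l (z : S → ℝ) => z (x j i l)) z * χ z
            ∂((gaussianFieldOfKernel K).map fun (ζ : S → ℝ) (y : S) => u y + ζ y)) Finset.univ -
      ursellOf (fun P : Finset σ => ∫ z, ∏ j ∈ P,
          poly (I j) (J j) (a j) (fun i l (z : S → ℝ) => z (x j i l)) z
            ∂((gaussianFieldOfKernel K).map fun (ζ : S → ℝ) (y : S) => u y + ζ y)) Finset.univ| ≤
      2 ^ Fintype.card σ * ((∑ π ∈ setPartitions (Finset.univ : Finset σ), ((π.card - 1)! : ℝ)) *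
        (η * ((1 + Ku) ^ q * M * momentConst q (2 * Fintype.card σ) c₀) ^ Fintype.card σ)) := by
  haveI := isProbabilityMeasure_gaussianFieldOfKernel hK
  have hTm : Measurable (fun (ζ : S → ℝ) (y : S) => u y + ζ y) :=
    measurable_pi_lambda _ fun y => measurable_const.add (measurable_pi_apply y)
  haveI : IsProbabilityMeasure ((gaussianFieldOfKernel K).map fun (ζ : S → ℝ) (y : S) => u y + ζ y) :=
    Measure.isProbabilityMeasure_map hTm.aemeasurable
  have hmc : 1 ≤ momentConst q (2 * Fintype.card σ) c₀ := one_le_momentConst _ _ _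
  have h1K : 0 ≤ (1 + Ku) ^ q := pow_nonneg (by linarith) _
  have hM0 : 0 ≤ M := (Finset.sum_nonneg fun i _ => abs_nonneg _).trans (hM (Classical.arbitrary σ))
  have hpk := fun j => poly_eval_shift_moments hK u hdiag (I j) (J j) (a j) (x j) hKu (hu j) (hq j)
    (2 * Fintype.card σ)
  refine abs_ursellOf_moment_mul_sub_le_of_moments
    (μ := (gaussianFieldOfKernel K).map fun (ζ : S → ℝ) (y : S) => u y + ζ y)
    (Z := fun j z => poly (I j) (J j) (a j) (fun i l (z : S → ℝ) => z (x j i l)) z)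
    (fun j => (hpk j).1) (fun j p _ => (hpk j).2.1 p) (fun j p hp => ((hpk j).2.2 p hp).trans ?_) hχm hχ0 hχ1
    (mul_nonneg (mul_nonneg h1K hM0) (zero_le_one.trans hmc)) hη0 hη1 htail
  exact pow_le_pow_left₀ (mul_nonneg (mul_nonneg h1K (Finset.sum_nonneg fun i _ => abs_nonneg _)) (zero_le_one.trans hmc))
    (mul_le_mul_of_nonneg_right (mul_le_mul_of_nonneg_left (hM j) h1K) (zero_le_one.trans hmc)) p

end ChiToOnePoly

end Literature.MathematicalPhysics.QuantumFieldTheory.Balaban1983to89.B1Eq324BenfattoKernelSect5SlotMoments
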